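import Mathlib
import Summits.Ventures.HodgeRepro0.P1LatticeIndexTwoExactHodge

/-!
# P1LatticeHodgeImage — D13's THEOREM A (proofs/P1-FermatLatticeClosure-v1.2.md l.4, DECLARED STATUS l.4789): THE CONVERSE
WEIGHT IDENTITY — THE KERNEL OF THE WEIGHT CONSTRAINTS IS THE SET OF ODD VECTORS OF THE HODGE MULTISETS (pub-hodge-repro0,
p1 (g29), 2026-08-30), on the general lemmas of lean/P1LatticeIndexTwoExactHodge.lean (the weight identity
`sum_oddVec_mul_wvec` / `sum_map_fval`, `conMat_mulVec_oddVec`, `mul_half_mod`, `units_ok_of_lists`).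

Supporting artefact in the sense of ROUTE.md R-5 (finite combinatorics / exact arithmetic only; never the discharge of a
Hodge-theoretic step; record-only).  Every p1 Lean artefact of D13's Theorem A takes H_M := the integer kernel of the weight
constraints Σₐ sₐ·(2·(t·a mod M) − M) = 0 (t over the units of ℤ/M) on the coordinates a ≤ ⌊(M−1)/2⌋ and carries the
caveat «the coordinate M/2 of an even M taken modulo 2e_{M/2} — the page's l.7 bookkeeping, not formalised»; the page
(proofs/P1-FermatLatticeClosure-v1.2.md l.7) defines H_M := {s(x) : x a Hodge multiset} and says that every integer vector
in the kernel (of the right parity) is s(x) for the multiset x with c_a = max(s_a, 0), c_{M−a} = max(−s_a, 0).  THIS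
ARTEFACT formalises that clause on the coordinates a < M/2: the kernel IS the set of odd vectors of the Hodge multisets
of level M (`ker_eq_image_hodge`), so the objects of every p1 artefact are the page's objects there, with the M/2
bookkeeping made explicit (the copies of M/2 in a Hodge multiset are exactly what an odd vector on a < M/2 cannot see:
they have odd vector 0 and fix the parity).

THE LEMMAS, for every M ≥ 2 and n = ⌊(M−1)/2⌋: `build M s` — the multiset with (s_a)⁺ copies of a + 1 and (s_a)⁻ copies of
M − (a + 1); `count_build_lo` / `count_build_hi` / `oddVec_build` — its odd vector is s; `mem_build` — its entries lie in
[1, M−1]; `card_build` / `card_build_int` — its cardinality is Σₐ |sₐ| = Σₐ sₐ + 2·Σₐ (sₐ)⁻; `oddVec_half` — copies of M/2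
(M even) have odd vector 0 on a < M/2; `sum_even_of_row_one` — at an odd M the row t = 1 forces Σₐ sₐ even
(M·Σₐ sₐ = 2·Σₐ (a+1)·sₐ); `exists_hodge_of_ker` — THE CONVERSE WEIGHT IDENTITY: if every unit of ℤ/M is a row
(`hcomplete`), every s in the kernel is the odd vector of a Hodge multiset — `build M s` plus one copy of M/2 when M is even
and the parity asks for it (its weight at a unit t is the weight identity of the Hodge file read backwards, and
t·(M/2) ≡ M/2); `ker_eq_image_hodge` — the kernel EQUALS oddVec '' {x | IsHodge M x} as sets (⊇ = `conMat_mulVec_oddVec`);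
`complete_of_lists` — every unit is a row, from a listed unit family equal to `unitsL M`.
The per-degree equalities are in lean/P1LatticeHodgeImageIndexTwo.lean (the 30 index-2 degrees of the g28 files A–N) and
lean/P1LatticeHodgeImageIndexOne.lean (the 88 index-1 degrees of the g27 files A–I).
NOT formalised: claim(·) for the blocks (Shioda 1981 Thm 4.3 / Lefschetz (1,1), Aoki 1987 Thm 2-1 / Thm 1-4); anything
Hodge-theoretic.
Nothing here asserts anything about whether the statement of README §1 has been proved elsewhere.
-/

namespace HodgeRepro0.P1.P1LatticeIndexTwoExact
open Matrix

/-- the multiset built from an odd vector s on the coordinates a < n: (s a)⁺ copies of a + 1 and (s a)⁻ copies of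
M − (a + 1) for every a (the page's «c_a = max(s_a, 0), c_{M−a} = max(−s_a, 0)») -/
def build (M : ℕ) {n : ℕ} (s : Fin n → ℤ) : Multiset ℕ :=
  ∑ a : Fin n, (Multiset.replicate (s a).toNat (a.val + 1) + Multiset.replicate (-(s a)).toNat (M - (a.val + 1)))

/-- the count of y in the built multiset, as a sum of indicators -/
theorem count_build {n : ℕ} (M : ℕ) (s : Fin n → ℤ) (y : ℕ) :
    (build M s).count y =
      ∑ a : Fin n, ((if a.val + 1 = y then (s a).toNat else 0) + (if M - (a.val + 1) = y then (-(s a)).toNat else 0)) := by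
  simp only [build, Multiset.count_sum', Multiset.count_add, Multiset.count_replicate]

/-- a sum of indicators over Fin n with exactly the coordinate a₀ hit (the condition as an equality of coordinates) -/
theorem sum_ind_eq {n : ℕ} (f : Fin n → ℕ) (a₀ : Fin n) (P : Fin n → Prop) [DecidablePred P] (hP : ∀ a, P a ↔ a = a₀) :
    ∑ a : Fin n, (if P a then f a else 0) = f a₀ := by
  have e : ∀ a : Fin n, (if P a then f a else 0) = if a = a₀ then f a else 0 := by
    intro a
    simp only [hP]
  simp only [e, Finset.sum_ite_eq', Finset.mem_univ, if_true]

/-- a sum of indicators over Fin n with no coordinate hit -/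
theorem sum_ind_none {n : ℕ} (f : Fin n → ℕ) (P : Fin n → Prop) [DecidablePred P] (hP : ∀ a, ¬ P a) :
    ∑ a : Fin n, (if P a then f a else 0) = 0 := by
  apply Finset.sum_eq_zero
  intro a _
  rw [if_neg (hP a)]

/-- the count of a + 1 in the built multiset is (s a)⁺ -/
theorem count_build_lo {n : ℕ} (M : ℕ) (hn : n = (M - 1) / 2) (s : Fin n → ℤ) (a : Fin n) :
    (build M s).count (a.val + 1) = (s a).toNat := by
  rw [count_build, Finset.sum_add_distrib]
  have ha := a.isLt
  rw [sum_ind_eq (fun a' => (s a').toNat) a _ (fun a' => by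
        constructor
        · intro h
          exact Fin.ext (by omega)
        · rintro rfl
          rfl),
    sum_ind_none (fun a' => (-(s a')).toNat) _ (fun a' => by have := a'.isLt; omega)]
  rfl

/-- the count of M − (a + 1) in the built multiset is (s a)⁻ -/
theorem count_build_hi {n : ℕ} (M : ℕ) (hn : n = (M - 1) / 2) (s : Fin n → ℤ) (a : Fin n) :
    (build M s).count (M - (a.val + 1)) = (-(s a)).toNat := by
  rw [count_build, Finset.sum_add_distrib]
  have ha := a.isLt
  rw [sum_ind_none (fun a' => (s a').toNat) _ (fun a' => by have := a'.isLt; omega),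
    sum_ind_eq (fun a' => (-(s a')).toNat) a _ (fun a' => by
        have := a'.isLt
        constructor
        · intro h
          exact Fin.ext (by omega)
        · rintro rfl
          rfl)]
  rw [Nat.zero_add]

/-- THE ODD VECTOR OF THE BUILT MULTISET IS s -/
theorem oddVec_build {n : ℕ} (M : ℕ) (hn : n = (M - 1) / 2) (s : Fin n → ℤ) : oddVec M (build M s) = s := by
  funext a
  rw [oddVec, count_build_lo M hn s a, count_build_hi M hn s a]
  exact Int.toNat_sub_toNat_neg (s a)

/-- the entries of the built multiset lie in [1, M−1] -/
theorem mem_build {n : ℕ} (M : ℕ) (hn : n = (M - 1) / 2) (s : Fin n → ℤ) (y : ℕ) (hy : y ∈ build M s) :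
    0 < y ∧ y < M := by
  simp only [build, Multiset.mem_sum, Multiset.mem_add, Multiset.mem_replicate, Finset.mem_univ, true_and] at hy
  obtain ⟨a, ⟨_, rfl⟩ | ⟨_, rfl⟩⟩ := hy <;> have := a.isLt <;> omega

/-- the cardinality of the built multiset is Σₐ |sₐ| -/
theorem card_build {n : ℕ} (M : ℕ) (s : Fin n → ℤ) :
    Multiset.card (build M s) = ∑ a : Fin n, ((s a).toNat + (-(s a)).toNat) := by
  simp only [build, Multiset.card_sum, Multiset.card_add, Multiset.card_replicate]

/-- the cardinality of the built multiset is Σₐ sₐ + 2·Σₐ (sₐ)⁻ (in ℤ) -/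
theorem card_build_int {n : ℕ} (M : ℕ) (s : Fin n → ℤ) :
    (Multiset.card (build M s) : ℤ) = ∑ a : Fin n, s a + 2 * ∑ a : Fin n, ((-(s a)).toNat : ℤ) := by
  rw [card_build]
  push_cast
  rw [Finset.mul_sum, ← Finset.sum_add_distrib]
  apply Finset.sum_congr rfl
  intro a _
  have := Int.toNat_sub_toNat_neg (s a)
  linarith

/-- the weight of a replicated entry -/
theorem wt_replicate (M t c y : ℕ) : wt M t (Multiset.replicate c y) = c * ((t * y) % M) := by
  simp [wt, Multiset.map_replicate, Multiset.sum_replicate]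

/-- the odd vector of copies of M/2 (M even) is 0 on the coordinates a < n = (M−1)/2 -/
theorem oddVec_half {n : ℕ} (M : ℕ) (hn : n = (M - 1) / 2) (hM : M % 2 = 0) (c : ℕ) :
    oddVec (n := n) M (Multiset.replicate c (M / 2)) = 0 := by
  funext a
  have := a.isLt
  simp only [oddVec, Multiset.count_replicate, Pi.zero_apply]
  rw [if_neg (by omega), if_neg (by omega)]
  simp

/-- THE PARITY AT AN ODD M: the row t = 1 of the weight constraints forces Σₐ sₐ even -/
theorem sum_even_of_row_one {n : ℕ} (M : ℕ) (hn : n = (M - 1) / 2) (hM : M % 2 = 1) (s : Fin n → ℤ)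
    (h : ∑ a : Fin n, (2 * (((1 * (a.val + 1)) % M : ℕ) : ℤ) - (M : ℤ)) * s a = 0) :
    Even (∑ a : Fin n, s a) := by
  have e : ∀ a : Fin n, (2 * (((1 * (a.val + 1)) % M : ℕ) : ℤ) - (M : ℤ)) * s a =
      2 * ((a.val + 1 : ℕ) : ℤ) * s a - (M : ℤ) * s a := by
    intro a
    have := a.isLt
    rw [Nat.one_mul, Nat.mod_eq_of_lt (by omega)]
    ring
  simp only [e, Finset.sum_sub_distrib, ← Finset.mul_sum] at h
  have h1 : ∑ a : Fin n, 2 * ((a.val + 1 : ℕ) : ℤ) * s a = 2 * ∑ a : Fin n, ((a.val + 1 : ℕ) : ℤ) * s a := by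
    rw [Finset.mul_sum]
    apply Finset.sum_congr rfl
    intro a _
    ring
  have hev : Even ((M : ℤ) * ∑ a : Fin n, s a) := ⟨∑ a : Fin n, ((a.val + 1 : ℕ) : ℤ) * s a, by linarith⟩
  rcases Int.even_mul.mp hev with hM' | hS
  · exfalso
    have : Even M := by exact_mod_cast hM'
    rw [Nat.even_iff] at this
    omega
  · exact hS

/-- THE CONVERSE WEIGHT IDENTITY: every integer vector s on the coordinates a < n = ⌊(M−1)/2⌋ satisfying every weight
constraint (every unit t of ℤ/M being a row) is the odd vector of a Hodge multiset of level M — the built multiset,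
plus one copy of M/2 when M is even and the parity asks for it (for an odd M the row t = 1 makes the parity even) -/
theorem exists_hodge_of_ker {n u : ℕ} (M : ℕ) (hM2 : 2 ≤ M) (hn : n = (M - 1) / 2) (unitsF : Fin u → ℕ)
    (hcomplete : ∀ t, t < M → Nat.gcd t M = 1 → ∃ i, unitsF i = t)
    (s : Fin n → ℤ) (hs : conMat (n := n) M unitsF *ᵥ s = 0) :
    ∃ x : Multiset ℕ, IsHodge M x ∧ oddVec M x = s := by
  -- every unit's row, as the weight identity on the built multiset
  have hrow : ∀ t, t < M → Nat.gcd t M = 1 → ∑ a : Fin n, (2 * (((t * (a.val + 1)) % M : ℕ) : ℤ) - (M : ℤ)) * s a = 0 := by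
    intro t ht hg
    obtain ⟨i, rfl⟩ := hcomplete t ht hg
    have := congrFun hs i
    simpa [Matrix.mulVec, dotProduct, conMat] using this
  have hwt : ∀ t, t < M → Nat.gcd t M = 1 → 2 * wt M t (build M s) = Multiset.card (build M s) * M := by
    intro t ht hg
    have h1 := sum_oddVec_mul_wvec (n := n) M t hn hg (build M s) (mem_build M hn s)
    rw [oddVec_build M hn s, sum_map_fval] at h1
    have h2 : ∑ a : Fin n, s a * wvec M t a = ∑ a : Fin n, (2 * (((t * (a.val + 1)) % M : ℕ) : ℤ) - (M : ℤ)) * s a := by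
      apply Finset.sum_congr rfl
      intro a _
      simp only [wvec]
      ring
    rw [h2, hrow t ht hg] at h1
    have h3 : ((2 * wt M t (build M s) : ℕ) : ℤ) = ((Multiset.card (build M s) * M : ℕ) : ℤ) := by
      push_cast
      linarith
    exact_mod_cast h3
  -- the parity fix
  set c : ℕ := if M % 2 = 0 then Multiset.card (build M s) % 2 else 0 with hc
  refine ⟨build M s + Multiset.replicate c (M / 2), ⟨?_, ?_, ?_⟩, ?_⟩
  · -- even cardinality
    rw [Multiset.card_add, Multiset.card_replicate, Nat.even_iff]
    rcases Nat.mod_two_eq_zero_or_one M with hM | hM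
    · rw [hc, if_pos hM]
      omega
    · rw [hc, if_neg (by omega), Nat.add_zero]
      have hev := sum_even_of_row_one M hn hM s (hrow 1 (by omega) (by simp))
      have hci := card_build_int M s
      obtain ⟨k, hk⟩ := hev
      have : (Multiset.card (build M s) : ℤ) % 2 = 0 := by
        rw [hci, hk]
        omega
      omega
  · -- the entries
    intro y hy
    rw [Multiset.mem_add] at hy
    rcases hy with hy | hy
    · exact mem_build M hn s y hy
    · rw [Multiset.mem_replicate] at hy
      obtain ⟨_, rfl⟩ := hy
      omega
  · -- the weights
    intro t ht hg
    rw [wt_add, wt_replicate, Multiset.card_add, Multiset.card_replicate, Nat.mul_add, hwt t ht hg]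
    rcases Nat.mod_two_eq_zero_or_one M with hM | hM
    · have hhalf : (t * (M / 2)) % M = M / 2 := mul_half_mod M t (M / 2) hg (by omega) (by omega)
      rw [hhalf]
      have : 2 * (M / 2) = M := by omega
      calc Multiset.card (build M s) * M + 2 * (c * (M / 2)) = Multiset.card (build M s) * M + c * (2 * (M / 2)) := by ring
        _ = Multiset.card (build M s) * M + c * M := by rw [this]
        _ = (Multiset.card (build M s) + c) * M := by ring
    · rw [hc, if_neg (by omega)]
      ring
  · -- the odd vector
    rw [oddVec_add, oddVec_build M hn s]
    rcases Nat.mod_two_eq_zero_or_one M with hM | hM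
    · rw [oddVec_half M hn hM c, add_zero]
    · have h0 : oddVec (n := n) M 0 = 0 := by
        funext a
        simp [oddVec]
      rw [hc, if_neg (by omega), Multiset.replicate_zero, h0, add_zero]

/-- H_M IS THE SET OF ODD VECTORS OF THE HODGE MULTISETS: the integer kernel of the weight constraints (every unit a row)
on the coordinates a < ⌊(M−1)/2⌋ equals the image of the Hodge multisets of level M under the odd vector -/
theorem ker_eq_image_hodge {n u : ℕ} (M : ℕ) (hM2 : 2 ≤ M) (hn : n = (M - 1) / 2) (unitsF : Fin u → ℕ)
    (hU : ∀ i, unitsF i < M ∧ Nat.gcd (unitsF i) M = 1)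
    (hcomplete : ∀ t, t < M → Nat.gcd t M = 1 → ∃ i, unitsF i = t) :
    (LinearMap.ker (Matrix.mulVecLin (conMat (n := n) M unitsF)) : Set (Fin n → ℤ)) =
      (oddVec (n := n) M) '' {x | IsHodge M x} := by
  ext s
  constructor
  · intro hs
    rw [SetLike.mem_coe, LinearMap.mem_ker, Matrix.mulVecLin_apply] at hs
    obtain ⟨x, hx, hxs⟩ := exists_hodge_of_ker M hM2 hn unitsF hcomplete s hs
    exact ⟨x, hx, hxs⟩
  · rintro ⟨x, hx, rfl⟩
    rw [SetLike.mem_coe, LinearMap.mem_ker, Matrix.mulVecLin_apply]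
    exact conMat_mulVec_oddVec M hn unitsF hU x hx

/-- every unit is a row, from a listed unit family equal to `unitsL M` -/
theorem complete_of_lists {u : ℕ} (M : ℕ) (unitsF : Fin u → ℕ) (UL : List ℕ) (h1 : List.ofFn unitsF = UL)
    (h2 : UL = unitsL M) (t : ℕ) (ht : t < M) (hg : Nat.gcd t M = 1) : ∃ i, unitsF i = t := by
  have hmem : t ∈ List.ofFn unitsF := by
    rw [h1, h2, mem_unitsL]
    exact ⟨ht, hg⟩
  exact List.mem_ofFn.mp hmem


end HodgeRepro0.P1.P1LatticeIndexTwoExact
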